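import Summits.QuantumFields.YangMills.Theses.PencilRigidity
import Summits.QuantumFields.YangMills.Theses.MirrorModularBoosts
import Summits.QuantumFields.YangMills.Theses.CoincidenceRotationBootstrap
import Summits.QuantumFields.YangMills.Theses.XiCompleteMonotonicity
import Literature.MathematicalPhysics.QuantumLattice.LatticeGaugeDLRLimitPointsProofs
import Summits.QuantumFields.YangMills.Theorems.HypercubicLimit.Negative.ExtendByZero
import Summits.QuantumFields.YangMills.Theorems.HypercubicLimit.Negative.NonTrivialityBridge
import Literature.MathematicalPhysics.QuantumLattice.LatticeGaugeDLR
import Literature.MathematicalPhysics.QuantumFieldTheory.LatticeGaugeProofs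
import HarnessLib.Audit

/-!
# Line `scale-locked-assembly` — crux `HypercubicLimit` (stmt-QuantumFields-8646)

Skeleton of the line "three lattice inputs stated at ONE scale, locked to the plaquette's own
correlation length, compose into the existence leg" for the crux
`Summit.QuantumFields.YangMills.Theses.PencilRigidity.HypercubicLimit` (shared verbatim with
routes `MirrorModularBoosts`, `CoincidenceRotationBootstrap`).

## The line in one paragraph

The crux asks for a Wilson scheme `sch = (a_k, β_k, L_k, c, m)` and a labelled Schwinger family
with every clause of `YangMills` minus rotations.  The only datum that couples the all-observable
clause `HasLatticeMassGap` to the one-species clauses (convergence on `⁰𝒮`, non-triviality,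
non-Gaussianity) is the SPACING `a_k`; reflection positivity makes the axial plaquette correlator
of every infinite-volume limit point completely monotone, `a(n) = ∫ λⁿ⁻¹ dν`, so the plaquette's
own mass `m_P(β) = -log sup supp ν` is canonically defined (`plaqMass`, via
`lambdaMax r β = sup_{μ, n} (|a_μ(n)|/a_μ(0))^{1/n}`), and the LOCK is: `a(β) := m_P(β)` —
one plaquette correlation length is one physical unit.  Every stub below is a statement about the
lattice theory at ONE inverse coupling `β` (and all tori `S ≥ S₀(β)`), indexed by that single
number; nothing else is chosen:
* `stub_lockDiverges` (XI): `λ_max(β) → 1`, i.e. the plaquette correlation length diverges as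
  `β → ∞` — needed so that `a_k → 0` (barrier `FixedCouplingUltralocality`).  It IS an existing
  item modulo glue PROVED in this file: `lockDiverges_of_xiDiverges : XiCompleteMonotonicity.XiDiverges
  → Statement.stub_lockDiverges` (item stmt-QuantumFields-8941, implied by that route's target
  `XiExpLowerBound` 8935; the glue uses only the discharged `infiniteVolumeLimitPoints_nonempty_holds`).
* `stub_lockedGap` (IR): `0 < m_P(β)` and the SPECTRAL form of the volume-uniform lattice gap at
  rate `c₀ · m_P(β)` — for gauge-invariant bounded observables `F, G` of the positive time slab
  `1 ≤ t ≤ D` of the odd torus `(ℤ/(2S+1))⁴`, `S ≥ S₀(β)`, `D + n ≤ S`: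
  `|⟨ΘF̄ · τₙG⟩ - ⟨F⟩⁻⟨G⟩| ≤ K ‖F‖_RP ‖G‖_RP e^{-c₀ m_P(β) n}` with the reflection-positivity norms
  `‖F‖²_RP = ⟨ΘF̄ F⟩ - |⟨F⟩|²` (what the transfer matrix gives; `K, c₀` uniform in `β`; sup-norm
  constants would be useless on `c_k`-renormalised smeared products — item 8896's recorded defect,
  triage r1-2's sharpening).  The rate is tied to the plaquette scale BY NAME: an IR engine whose
  rate is not comparable to `1/ξ_P(β)` does not prove this stub (the card's NECESSITY theorem).
* `stub_lockedGrowth` (UV): at the locked spacing, with the centred UNRENORMALISED smeared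
  curvature field `φ_{β,S}(f) = a⁴ ∑ₓ f(a x)(P_x - ⟨P⟩)` (`lockedField`, `a = m_P(β)`), there is a
  positive-time reference test function `u` whose reflection-positive two-point value
  `Q = ⟨φ(θu) φ(u)⟩` (`refTwoPoint`) is `> 0` and controls ALL off-diagonal `n`-point functions,
  `β`- and volume-uniformly, in Osterwalder–Schrader's E0' shape:
  `‖𝔖ₙ^{β,S,κ}(F)‖ ≤ α (n!)^γ |F|_{ns} Q^{n/2}` for `F ∈ ⁰𝒮` and every string `κ` of coordinate
  planes (`lockedPlaneDist` = the lattice `n`-point distributions of the six elementary plaquette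
  fields, whose sum over `μ < ν` is the curvature field; the multiplet is needed because lattice
  reflections / signed permutations move individual planes by one lattice step).  This is the
  k-uniform E0′/tightness input (triage r1-1 (iii): smeared RP normalisation instead of the
  on-axis `G_k(N_k)`).
* `stub_lockedSkewness` (NG): for every positive-time reference `u` there are time-separated
  real `f, g, h` and `c₃ > 0` with `|⟨φ(f)φ(g)φ(h)⟩| ≥ c₃ Q^{3/2}` eventually — the scale-free
  non-Gaussianity of the coupling-conjugate species (suppliers: crux ideas `running-pole-skewness`,
  or a UV engine at three-gluon order; Disproof §2: the two non-triviality clauses are the whole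
  obstruction, §3: non-abelian `G` enters only here).
* `stub_lockedOSLimit` (TRANSFER, the card's `OSLimitFromLockedInputs`): for fixed `(G, r)` the
  four inputs give a scheme and a ONE-FIELD Schwinger family with every clause of the crux
  (`OneFieldClauses`): `β_k → ∞` arbitrary, `a_k := m_P(β_k)` (→ 0 by XI, > 0 by IR),
  `L_k := max (S₀, S₁, S₂) (β_k) ⊔ ⌈a_k⁻¹⌉²` (so `a_k L_k → ∞`), `c_k := Q_k^{-1/2}`,
  `m_k := ⟨P⟩_{β_k, L_k}`; compactness from the uniform E0' bound (equicontinuous functionals on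
  the Fréchet space `⁰𝒮`, diagonal subsequence — licensed because `sch` is witness data, ruling Y2),
  E0/E2/E3 and translation / proper-hypercubic invariance inherited (lattice symmetries up to
  `a_k`-translations, closed by the uniform continuity modulus), E4 + `HasMassGap c₀` from IR in
  RP norms (which ARE off-diagonal two-point values, bounded by UV), `HasLatticeMassGap r sch c₀`
  verbatim from IR (`n ≤ S`, thermal wrap-around absorbed since `D + n ≤ S`), non-triviality because
  the normalised `Q ≡ 1` (landed `Negative.twoPointNontrivial_of_real`), non-Gaussianity from NG.
`HypercubicLimit_of` composes: pick the faithful `r` that `IsCompactSimpleLieGroup G` provides,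
run the transfer, then silence every other species (`onlySpecies`, `c_s ≡ 0`) and extend the
one-field family by zero (landed `Negative.extendByZero`, Disproof §4 `hypercubicLimit_iff_oneField`)
— a real proof, no `sorry`.

## Disproof used (Cruxes/HypercubicLimit/Disproof.lean, cycle 2)

§4 one-field reduction (the composition IS it); §2/§3 (`clausesWithoutNontriviality_vacuum`,
`hypercubicLimit_false_without_nonabelian`): all content sits in non-triviality/non-Gaussianity —
honoured: the line uses non-abelianness exactly at `stub_lockedSkewness`/`stub_lockedGrowth`
(`Q > 0`, `c₃ > 0` are false for `G = PUnit`, where every `lockedMoment` factorises to `0`);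
§1 (`hasLatticeMassGap_of_beta_eq_zero`): the gap clause alone is blind — here it is tied to the
convergence clause through the shared `β` and the lock `a = m_P(β)`; §5 (`n ≤ S` load-bearing,
periodicity): IR is stated with `D + n ≤ S` on the torus, never for all times
(`Negative.AllTimesGapFalse`).  No `-- Targets` stub kill applies (new stubs).
-/

noncomputable section

open scoped SchwartzMap ComplexConjugate
open MeasureTheory Filter Topology Complex
open Literature.MathematicalPhysics.AQFT Literature.MathematicalPhysics.QuantumLattice
open Literature.MathematicalPhysics.QuantumFieldTheory

namespace Summit.QuantumFields.YangMills.Cruxes.HypercubicLimit.ScaleLockedAssembly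

local notation "E4" => EuclideanSpace ℝ (Fin 4)

/-- Odd torus sides are never zero. -/
instance instNeZeroOddSide (S : ℕ) : NeZero (2 * S + 1) := ⟨Nat.succ_ne_zero _⟩

section Defs

variable {G : Type} [Group G] [TopologicalSpace G] [IsTopologicalGroup G] [CompactSpace G]
  [MeasurableSpace G] [BorelSpace G]

/-! ### The lock scale: the plaquette's own mass, canonically -/

/-- The axial plaquette–plaquette correlator `a_μ(n) = f_μ(n e₀)` of a state `μ` on `ℤ⁴`
(Chatterjee's `f_β`, tree `plaquetteCorrFn`; the vocabulary of route `XiCompleteMonotonicity`). -/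
def axialCorr (r : LatticeRep G) (μ : Measure (LGConfig 4 G)) (n : ℕ) : ℝ :=
  plaquetteCorrFn r.ρ μ ((n : ℤ) • Pi.single (0 : Fin 4) (1 : ℤ))

/-- `λ_max(β) ∈ [0, 1]`: the supremum over infinite-volume limit points `μ` at inverse coupling `β`
and over `n ≥ 1` of `(|a_μ(n)| / a_μ(0))^{1/n}` clamped to `[0, 1]`.  For a reflection-positive limit point
`a_μ(n) = ∫ λⁿ⁻¹ dν_μ(λ)` is completely monotone and the inner supremum is `sup supp ν_μ = e^{-m_μ}`,
the exponential decay rate of the plaquette in the state `μ`; the outer supremum takes the longest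
plaquette correlation length among limit points.  No limit is taken: the definition is total
(the clamp makes every supremum one of a `[0, 1]`-valued family; empty suprema are `0`). -/
def lambdaMax (r : LatticeRep G) (β : ℝ) : ℝ :=
  ⨆ μ : infiniteVolumeLimitPoints (d := 4) r.ρ β, ⨆ n : ℕ,
    max 0 (min 1 ((|axialCorr r (μ : Measure (LGConfig 4 G)) (n + 1)| /
      axialCorr r (μ : Measure (LGConfig 4 G)) 0) ^ ((n : ℝ) + 1)⁻¹))

/-- **The lock.** `m_P(β) := -log λ_max(β)`, the plaquette mass in lattice units (inverse lattice
correlation length of the curvature species); the line's lattice spacing IS this number,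
`a(β) := m_P(β)`, so that one plaquette correlation length is one physical unit.  (`Real.log 0 = 0`:
the junk value `m_P = 0` at ultralocal or massless points is excluded by `stub_lockedGap`'s
`0 < m_P(β)`.) -/
def plaqMass (r : LatticeRep G) (β : ℝ) : ℝ := - Real.log (lambdaMax r β)

/-! ### Torus objects at one coupling `β` and half-side `S` (side `2S+1`, as in the scheme) -/

/-- The torus Wilson state `μ_{Λ_{2S+1}, β}` in the representation of `r`. -/
abbrev torusState (r : LatticeRep G) (β : ℝ) (S : ℕ) : Measure (GaugeConfig 4 (2 * S + 1) G) :=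
  wilsonMeasure (d := 4) (L := 2 * S + 1) r.ρ β

/-- The torus mean `⟨P⟩_{β,S}` of the curvature observable (the additive counterterm `m`). -/
def curvMean (r : LatticeRep G) (β : ℝ) (S : ℕ) : ℝ :=
  ∫ U, r.curvature.F (torusLift (2 * S + 1) U) ∂(torusState r β S)

/-- The centred, UNrenormalised (`c = 1`) smeared curvature field at the locked spacing
`a = m_P(β)` on the torus of half-side `S`: `φ_{β,S}(f)(U) = a⁴ ∑_{x ∈ box S} f(a x) (P(τₓŨ) - ⟨P⟩)`
— literally `smearedLatticeField` with `(a, c, m) = (plaqMass r β, 1, curvMean r β S)`. -/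
def lockedField (r : LatticeRep G) (β : ℝ) (S : ℕ) (f : 𝓢(E4, ℝ))
    (U : GaugeConfig 4 (2 * S + 1) G) : ℝ :=
  smearedLatticeField r.curvature.F (Literature.Probability.LatticeModels.box 4 S) (plaqMass r β) 1
    (curvMean r β S) f (torusLift (2 * S + 1) U)

/-- Torus `n`-point moments of the locked field on real test functions,
`M_n^{β,S}(f) = ⟨∏ᵢ φ_{β,S}(fᵢ)⟩_{β,S}` (so that `latticeSchwinger` of a locked scheme is
`c_kⁿ · M_n`). -/
def lockedMoment (r : LatticeRep G) (β : ℝ) (S : ℕ) (n : ℕ) (f : Fin n → 𝓢(E4, ℝ)) : ℝ :=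
  ∫ U, ∏ i, lockedField r β S (f i) U ∂(torusState r β S)

/-- The elementary plaquette observable of the coordinate plane `p = (μ, ν)` at the origin,
`Re tr ρ(U_{p_{μν}(0)})` (for `μ = ν` the constant `N`); the curvature observable is
`actionDensity = ∑_{μ<ν} planeObs (μ, ν)`.  The UV input is stated for this MULTIPLET because
lattice reflections and signed permutations permute the six plaquettes of the action density only up
to one-step translations of individual planes (temporal plaquettes sit at half-integer times), and
the transfer closes those `a_k`-shifts with the uniform continuity modulus plane by plane. -/
def planeObs (r : LatticeRep G) (p : Fin 4 × Fin 4) : LGConfig 4 G → ℝ :=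
  plaquetteObs r.ρ 0 p.1 p.2

/-- The torus mean of the plane-`p` plaquette. -/
def planeMean (r : LatticeRep G) (β : ℝ) (S : ℕ) (p : Fin 4 × Fin 4) : ℝ :=
  ∫ U, planeObs r p (torusLift (2 * S + 1) U) ∂(torusState r β S)

/-- The lattice `n`-point DISTRIBUTIONS of the locked plaquette multiplet: for a plane string
`κ : Fin n → Fin 4 × Fin 4` and `F ∈ 𝓢((ℝ⁴)ⁿ, ℂ)`,
`𝔖ₙ^{β,S,κ}(F) = a^{4n} ∑_{x₁…xₙ ∈ box S} F(a x₁, …, a xₙ) ⟨∏ᵢ (P^{κᵢ}(τ_{xᵢ}Ũ) - ⟨P^{κᵢ}⟩)⟩_{β,S}`,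
`a = m_P(β)` — finite sums of point evaluations, UNrenormalised (`c = 1`).  Summing `κ` over the
strings of planes `μ < ν` gives the `n`-point distribution of the locked curvature field, which on a
real tensor `⊗ᵢ fᵢ` is `lockedMoment r β S n f`. -/
def lockedPlaneDist (r : LatticeRep G) (β : ℝ) (S : ℕ) (n : ℕ) (κ : Fin n → Fin 4 × Fin 4)
    (F : 𝓢((Fin n → E4), ℂ)) : ℂ :=
  ∑ x ∈ Fintype.piFinset (fun _ : Fin n => Literature.Probability.LatticeModels.box 4 S),
    ((((plaqMass r β) ^ 4) ^ n : ℝ) : ℂ) * F (fun i => (plaqMass r β) • siteToE (x i)) *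
      ((∫ U, ∏ i, (planeObs r (κ i) (configShift (-(x i)) (torusLift (2 * S + 1) U)) -
          planeMean r β S (κ i)) ∂(torusState r β S) : ℝ) : ℂ)

/-- The reflection-positive reference two-point value `Q_u(β, S) = ⟨φ(θu) φ(u)⟩_{β,S}` of a
positive-time real test function `u` (`θ` = time reflection of test functions): the quantity whose
inverse square root is the multiplicative renormalisation `c_k` of the line (triage r1-1 (iii)). -/
def refTwoPoint (r : LatticeRep G) (β : ℝ) (S : ℕ) (u : 𝓢(E4, ℝ)) : ℝ :=
  lockedMoment r β S 2 ![thetaTest 4 u, u]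

/-! ### Objects of the spectral (reflection-positivity) form of the lattice gap -/

/-- The links of the torus of side `L` lying in the positive time slab `1 ≤ t ≤ D`, endpoints
included (temporal links based at `t` end at `t + 1`).  For `D ≤ L / 2` this is inside the positive
half of the odd-torus reflection `θ t = 1 - t` (`WilsonOddRP.oPosEdges`). -/
def slabEdges (L D : ℕ) : Set (Edge 4 L) :=
  {e | 1 ≤ (e.1 0).val ∧ (e.1 0).val ≤ D ∧ (e.2 = 0 → (e.1 0).val + 1 ≤ D)}

/-- Time shift of torus configurations by `n` lattice units: `(timeShift n U)(x, i) = U(x + n e₀, i)`,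
so that `G ∘ timeShift n` reads the slab `[1 + n, D + n]` when `G` reads `[1, D]` (the sign
convention of `latticeConnectedCorr`). -/
def timeShift {L : ℕ} (n : ℕ) (U : GaugeConfig 4 L G) : GaugeConfig 4 L G :=
  torusConfigShift (-(Pi.single (0 : Fin 4) ((n : ℕ) : ZMod L))) U

/-- The reflection-positivity pairing `⟨Θ F̄ · G⟩_{β,S}` on the odd torus, `(ΘF̄)(U) = conj F(θU)`
with Wave 0's `GaugeConfig.timeReflect` (`θ t = 1 - t`; `wilsonExpectation_oddReflectionPositive`
makes `⟨ΘF̄ · F⟩ ≥ 0` for positive-half `F`, `β ≥ 0`). -/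
def rpPair (r : LatticeRep G) (β : ℝ) (S : ℕ) (F G' : GaugeConfig 4 (2 * S + 1) G → ℂ) : ℂ :=
  wilsonExpectation (d := 4) (L := 2 * S + 1) r.ρ β fun U => conj (F U.timeReflect) * G' U

/-- The torus mean `⟨F⟩_{β,S}` of a complex observable. -/
def tmean (r : LatticeRep G) (β : ℝ) (S : ℕ) (F : GaugeConfig 4 (2 * S + 1) G → ℂ) : ℂ :=
  wilsonExpectation (d := 4) (L := 2 * S + 1) r.ρ β F

/-! ### The four lattice inputs, each indexed by the lock scale alone -/

/-- **(XI) the lock scale diverges**: `λ_max(β) → 1` as `β → ∞`, i.e. `ξ_P(β) = 1/m_P(β) → ∞` —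
the critical point sits at `β = ∞`.  Implied by `XiCompleteMonotonicity.XiDiverges` (8941) with
`infiniteVolumeLimitPoints_nonempty_holds` — PROVED below (`lockDiverges_of_xiDiverges`: a bound
`A e^{-mn} ≤ a_μ(n)`, `m ≤ ε`, gives `(a_μ(n)/a_μ(0))^{1/n} ≥ (A/a_μ(0))^{1/n} e^{-m} → e^{-m}`). -/
def LockDiverges (r : LatticeRep G) : Prop :=
  Tendsto (fun β : ℝ => lambdaMax r β) atTop (𝓝 1)

/-- **(IR) the volume-uniform lattice gap at the plaquette's own rate — plain and spectral form.**
There are `β₁, c₀ > 0, K` and torus thresholds `S₀(β)` such that: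
(a) for every pair of local gauge-invariant observables `A, B` there is `C` (uniform in `β`) with
`|⟨A · τₙB⟩_{β,S} - ⟨A⟩⟨B⟩| ≤ C e^{-c₀ m_P(β) n}` for all `β ≥ β₁` with `m_P(β) ≤ 1`, all
`S ≥ S₀(β)` and ALL `n ≤ S` — literally the atoms of `HasLatticeMassGap` (`latticeConnectedCorr`
on the torus of side `2S+1`) with rate `c₀ m_P(β)` in lattice units;
(b) for every `β ≥ β₁`: `0 < m_P(β)`, and if `m_P(β) ≤ 1` then on every odd torus of half-side
`S ≥ S₀(β)`, for all `D, n` with `2D + n ≤ S` (both ways round the time circle stay `≥ S + 1`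
slices free) and all bounded measurable gauge-invariant observables `F, G` of the slab
`1 ≤ t ≤ D`, the SPECTRAL bound in reflection-positivity norms
`‖⟨ΘF̄ · (G ∘ τₙ)⟩ - conj⟨F⟩⟨G⟩‖ ≤ K √(Re⟨ΘF̄F⟩ - |⟨F⟩|²) √(Re⟨ΘḠG⟩ - |⟨G⟩|²) e^{-c₀ m_P(β) n}
  + K ‖F‖_∞ ‖G‖_∞ e^{-c₀ m_P(β) S}`.
(b) is exactly what a spectral gap `≥ c₀ m_P(β)` of the transfer matrix `T_S ≥ 0` above its simple
top eigenvalue gives on the finite torus: the vacuum-sector term in RP norms (the norms the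
continuum limit sees: they are off-diagonal two-point values of the UNrenormalised products, so
`c_k`-renormalisation costs nothing — sup-norm constants alone would be useless, item 8896's
recorded defect, triage r1-2) plus the wrap-around of excited states the long way, which is
`≤ ‖F‖‖G‖ ∑_{i≥1} (λᵢ/λ₀)^{S+1}`, small once `S ≥ S₀(β) ≍ ξ_P log ξ_P` (density of states — the
supplier's burden, triage r1-3).  (a) is the same estimate for fixed observables and all `n ≤ S`
(near the antipode the two ways round are comparable; sup norms are harmless for FIXED `A, B`).
The rate is tied to the plaquette scale BY NAME: `c₀ ≤ 1` is forced, `c₀ = 1` expected (the scalar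
glueball is the lightest state); an IR engine whose rate is not comparable to `1/ξ_P(β)` does not
prove this stub (the card's necessity theorem). -/
def LockedGap (r : LatticeRep G) : Prop :=
  ∃ β₁ c₀ K : ℝ, 0 < c₀ ∧ ∃ S₀ : ℝ → ℕ,
    (∀ A B : YMSpecies G, ∃ C : ℝ, ∀ β : ℝ, β₁ ≤ β → plaqMass r β ≤ 1 →
      ∀ S : ℕ, S₀ β ≤ S → ∀ n : ℕ, n ≤ S →
        |latticeConnectedCorr r.ρ β (2 * S + 1) A.F B.F n| ≤
          C * Real.exp (-(c₀ * plaqMass r β * n))) ∧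
    ∀ β : ℝ, β₁ ≤ β →
      0 < plaqMass r β ∧
      (plaqMass r β ≤ 1 → ∀ S : ℕ, S₀ β ≤ S → ∀ D n : ℕ, 2 * D + n ≤ S →
        ∀ (F G' : GaugeConfig 4 (2 * S + 1) G → ℂ) (C_F C_G : ℝ), Measurable F → Measurable G' →
          (∀ U, ‖F U‖ ≤ C_F) → (∀ U, ‖G' U‖ ≤ C_G) →
          DependsOn F (slabEdges (2 * S + 1) D) → DependsOn G' (slabEdges (2 * S + 1) D) →
          IsGaugeInvariant F → IsGaugeInvariant G' →
            ‖rpPair r β S F (G' ∘ timeShift n) - conj (tmean r β S F) * tmean r β S G'‖ ≤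
              K * Real.sqrt ((rpPair r β S F F).re - ‖tmean r β S F‖ ^ 2) *
                  Real.sqrt ((rpPair r β S G' G').re - ‖tmean r β S G'‖ ^ 2) *
                  Real.exp (-(c₀ * plaqMass r β * n)) +
                K * C_F * C_G * Real.exp (-(c₀ * plaqMass r β * S)))

/-- **(UV) uniform linear growth of the plaquette multiplet at the locked spacing, in units of one
reflection-positive two-point value.**  There are a real reference test function `u` supported in
positive times, `β₁`, thresholds `S₁(β)`, an order `s` and constants `α, γ` such that for all
`β ≥ β₁` with `0 < m_P(β) ≤ 1` and all `S ≥ S₁(β)`: `Q_u(β,S) > 0` and, for every `n`, every plane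
string `κ` and every `F ∈ ⁰𝒮((ℝ⁴)ⁿ)`, `‖𝔖ₙ^{β,S,κ}(F)‖ ≤ α (n!)^γ |F|_{n s} Q_u(β,S)^{n/2}` —
Osterwalder–Schrader's E0' for the `Q_u^{-1/2}`-renormalised elementary plaquette fields (hence,
summing `≤ 6ⁿ ≤ 65·n!` strings, for the curvature field), uniformly in the coupling and the volume:
the k-uniform tightness of renormalised `tr F²` correlators on `⁰𝒮` (dimension-4 singularities at
coincident points are invisible on `⁰𝒮`). -/
def LockedGrowth (r : LatticeRep G) : Prop :=
  ∃ u : 𝓢(E4, ℝ), tsupport u ⊆ {y : E4 | 0 < y 0} ∧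
    ∃ β₁ : ℝ, ∃ S₁ : ℝ → ℕ, ∃ (s : ℕ) (α γ : ℝ), ∀ β : ℝ, β₁ ≤ β → 0 < plaqMass r β →
      plaqMass r β ≤ 1 → ∀ S : ℕ, S₁ β ≤ S →
        0 < refTwoPoint r β S u ∧
        ∀ (n : ℕ) (κ : Fin n → Fin 4 × Fin 4) (F : 𝓢((Fin n → E4), ℂ)), IsOffDiagonal F →
          ‖lockedPlaneDist r β S n κ F‖ ≤
            α * (n.factorial : ℝ) ^ γ * schwartzNorm (n * s) F * Real.sqrt (refTwoPoint r β S u) ^ n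

/-- **(NG) scale-free non-Gaussianity of the coupling-conjugate species.**  For every real
reference `u` supported in positive times there are real `f, g, h` supported in three successive
open time slabs (so `f ⊗ g ⊗ h ∈ ⁰𝒮` together with all its sub-tensors), `c₃ > 0`, `β₂` and
thresholds `S₂(β)` with `c₃ Q_u(β,S)^{3/2} ≤ |⟨φ(f)φ(g)φ(h)⟩_{β,S}|` for all `β ≥ β₂` with
`0 < m_P(β) ≤ 1` and all `S ≥ S₂(β)` (the field is centred, so the third moment IS the connected
three-point function; `Q_u` can only be anomalously small, never large, so the universal
quantifier over `u` costs nothing). -/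
def LockedSkewness (r : LatticeRep G) : Prop :=
  ∀ u : 𝓢(E4, ℝ), tsupport u ⊆ {y : E4 | 0 < y 0} →
    ∃ (f g h : 𝓢(E4, ℝ)) (t₁ t₂ : ℝ), tsupport f ⊆ {y : E4 | 0 < y 0 ∧ y 0 < t₁} ∧
      tsupport g ⊆ {y : E4 | t₁ < y 0 ∧ y 0 < t₂} ∧ tsupport h ⊆ {y : E4 | t₂ < y 0} ∧
      ∃ c₃ : ℝ, 0 < c₃ ∧ ∃ β₂ : ℝ, ∃ S₂ : ℝ → ℕ, ∀ β : ℝ, β₂ ≤ β → 0 < plaqMass r β →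
        plaqMass r β ≤ 1 → ∀ S : ℕ, S₂ β ≤ S →
          c₃ * Real.sqrt (refTwoPoint r β S u) ^ 3 ≤ |lockedMoment r β S 3 ![f, g, h]|

/-- **The crux for one group, one representation, ONE scalar field** (Disproof §4 `Clauses₁`,
unbundled over tree objects only): E0 (normalisation, hermiticity), E0', E2, E3, E4, translation
and proper-hypercubic invariance on `⁰𝒮` of `S₁`; convergence of the renormalised curvature
`n`-point functions along `sch` to `S₁` on real off-diagonal tensors; non-triviality;
non-Gaussianity; a continuum gap and the uniform lattice gap with one rate `Δ > 0`. -/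
def OneFieldClauses (r : LatticeRep G) (sch : SpeciesScheme (YMSpecies G))
    (S₁ : SchwingerFamily E4) : Prop :=
  (S₁.toLabelled.IsNormalized ∧ S₁.toLabelled.IsHermitian ∧ S₁.toLabelled.HasLinearGrowth ∧
      S₁.toLabelled.IsReflectionPositive ∧ S₁.toLabelled.IsSymmetric ∧
      S₁.toLabelled.HasClusterProperty ∧
      (∀ (n : ℕ) (k : Fin n → Unit) (a : E4) (F : 𝓢((Fin n → E4), ℂ)), IsOffDiagonal F →
        S₁.toLabelled n k (translateMulti a F) = S₁.toLabelled n k F) ∧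
      (∀ (n : ℕ) (k : Fin n → Unit) (R : E4 ≃ₗᵢ[ℝ] E4),
        LinearMap.det (R.toLinearEquiv : E4 →ₗ[ℝ] E4) = 1 →
        (∀ i : Fin 4, ∃ j : Fin 4, R (EuclideanSpace.single i 1) = EuclideanSpace.single j 1 ∨
          R (EuclideanSpace.single i 1) = -EuclideanSpace.single j 1) →
        ∀ F : 𝓢((Fin n → E4), ℂ), IsOffDiagonal F →
          S₁.toLabelled n k (linActMulti R F) = S₁.toLabelled n k F)) ∧
    (∀ (n : ℕ), n ≠ 0 → ∀ (f : Fin n → 𝓢(E4, ℝ)) (F : 𝓢((Fin n → E4), ℂ)),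
      IsTensorOf F (fun i => ofRealTest (f i)) → IsOffDiagonal F →
        Tendsto (fun k : ℕ =>
          ((latticeSchwinger r.ρ sch (fun s => s.F) k n (fun _ => r.curvature) f : ℝ) : ℂ))
          atTop (𝓝 (S₁ n F))) ∧
    (∃ (F₁ G₁ : 𝓢((Fin 1 → E4), ℂ)) (H₁ : 𝓢((Fin (1 + 1) → E4), ℂ)),
      IsTimeOrdered F₁ ∧ IsTimeOrdered G₁ ∧ IsAppendTensorOf H₁ (osAdjoint F₁) G₁ ∧
        S₁ (1 + 1) H₁ ≠ S₁ 1 (osAdjoint F₁) * S₁ 1 G₁) ∧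
    (∃ (f g h : 𝓢(E4, ℂ)) (Ffgh : 𝓢((Fin 3 → E4), ℂ)) (Fgh Ffh Ffg : 𝓢((Fin 2 → E4), ℂ))
        (Ff Fg Fh : 𝓢((Fin 1 → E4), ℂ)),
      IsTensorOf Ffgh ![f, g, h] ∧ IsOffDiagonal Ffgh ∧ IsTensorOf Fgh ![g, h] ∧
      IsTensorOf Ffh ![f, h] ∧ IsTensorOf Ffg ![f, g] ∧ IsTensorOf Ff ![f] ∧ IsTensorOf Fg ![g] ∧
      IsTensorOf Fh ![h] ∧
        S₁ 3 Ffgh - S₁ 1 Ff * S₁ 2 Fgh - S₁ 1 Fg * S₁ 2 Ffh - S₁ 1 Fh * S₁ 2 Ffg +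
          2 * (S₁ 1 Ff * S₁ 1 Fg * S₁ 1 Fh) ≠ 0) ∧
    (∃ Δ : ℝ, 0 < Δ ∧ S₁.toLabelled.HasMassGap Δ ∧ HasLatticeMassGap r sch Δ)

end Defs

/-! ### The registered stubs (statements) -/

namespace Statement

/-- Stub XI — the lock scale diverges (see `LockDiverges`). -/
def stub_lockDiverges : Prop :=
  ∀ (G : Type) [Group G] [TopologicalSpace G] [IsTopologicalGroup G] [CompactSpace G]
    [MeasurableSpace G] [BorelSpace G], IsCompactSimpleLieGroup G →
      ∀ r : LatticeRep G, LockDiverges r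

/-- Stub IR — the spectral lattice gap at the plaquette's rate (see `LockedGap`). -/
def stub_lockedGap : Prop :=
  ∀ (G : Type) [Group G] [TopologicalSpace G] [IsTopologicalGroup G] [CompactSpace G]
    [MeasurableSpace G] [BorelSpace G], IsCompactSimpleLieGroup G →
      ∀ r : LatticeRep G, LockedGap r

/-- Stub UV — uniform linear growth at the locked spacing (see `LockedGrowth`). -/
def stub_lockedGrowth : Prop :=
  ∀ (G : Type) [Group G] [TopologicalSpace G] [IsTopologicalGroup G] [CompactSpace G]
    [MeasurableSpace G] [BorelSpace G], IsCompactSimpleLieGroup G →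
      ∀ r : LatticeRep G, LockedGrowth r

/-- Stub NG — scale-free non-Gaussianity (see `LockedSkewness`). -/
def stub_lockedSkewness : Prop :=
  ∀ (G : Type) [Group G] [TopologicalSpace G] [IsTopologicalGroup G] [CompactSpace G]
    [MeasurableSpace G] [BorelSpace G], IsCompactSimpleLieGroup G →
      ∀ r : LatticeRep G, LockedSkewness r

/-- Stub TRANSFER (`OSLimitFromLockedInputs`) — the four locked inputs for `(G, r)` give a scheme
and a one-field Schwinger family with every clause of the crux (see the module docstring for the
intended scheme `a_k := m_P(β_k)`, `c_k := Q_k^{-1/2}`, `m_k := ⟨P⟩`, oversized `L_k`). -/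
def stub_lockedOSLimit : Prop :=
  ∀ (G : Type) [Group G] [TopologicalSpace G] [IsTopologicalGroup G] [CompactSpace G]
    [MeasurableSpace G] [BorelSpace G], IsCompactSimpleLieGroup G →
      ∀ r : LatticeRep G, LockDiverges r → LockedGap r → LockedGrowth r → LockedSkewness r →
        ∃ (sch : SpeciesScheme (YMSpecies G)) (S₁ : SchwingerFamily E4), OneFieldClauses r sch S₁

end Statement

/-! ### The registered stubs (sorried) -/

/-- XI. -/
theorem stub_lockDiverges : Statement.stub_lockDiverges := by
  sorry

/-- IR. -/
theorem stub_lockedGap : Statement.stub_lockedGap := by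
  sorry

/-- UV. -/
theorem stub_lockedGrowth : Statement.stub_lockedGrowth := by
  sorry

/-- NG. -/
theorem stub_lockedSkewness : Statement.stub_lockedSkewness := by
  sorry

/-- TRANSFER. -/
theorem stub_lockedOSLimit : Statement.stub_lockedOSLimit := by
  sorry

/-! ### XI is an existing item: `XiCompleteMonotonicity.XiDiverges` (stmt-QuantumFields-8941) ⇒ stub XI -/

section XiGlue

variable {G : Type} [Group G] [TopologicalSpace G] [IsTopologicalGroup G] [CompactSpace G]
  [MeasurableSpace G] [BorelSpace G]

omit [IsTopologicalGroup G] [CompactSpace G] [BorelSpace G] in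
/-- Every term of the family defining `lambdaMax` lies in `[0, 1]`. -/
theorem lambdaTerm_mem (r : LatticeRep G) (μ : Measure (LGConfig 4 G)) (n : ℕ) :
    0 ≤ max 0 (min 1 ((|axialCorr r μ (n + 1)| / axialCorr r μ 0) ^ ((n : ℝ) + 1)⁻¹)) ∧
      max 0 (min 1 ((|axialCorr r μ (n + 1)| / axialCorr r μ 0) ^ ((n : ℝ) + 1)⁻¹)) ≤ 1 :=
  ⟨le_max_left _ _, max_le zero_le_one (min_le_left _ _)⟩

/-- `0 ≤ λ_max(β) ≤ 1`. -/
theorem lambdaMax_mem (r : LatticeRep G) (β : ℝ) : 0 ≤ lambdaMax r β ∧ lambdaMax r β ≤ 1 :=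
  ⟨Real.iSup_nonneg fun μ => Real.iSup_nonneg fun n => (lambdaTerm_mem r μ n).1,
    Real.iSup_le (fun μ => Real.iSup_le (fun n => (lambdaTerm_mem r μ n).2) zero_le_one) zero_le_one⟩

/-- A lower bound `A e^{-m n} ≤ a_μ(n)` (`A > 0`, `0 ≤ m`) at ONE limit point forces
`λ_max(β) ≥ (A / a_μ(0))^{1/(n+1)} e^{-m}` for every `n`. -/
theorem rpow_mul_exp_le_lambdaMax (r : LatticeRep G) {β : ℝ} {μ : Measure (LGConfig 4 G)}
    (hμ : μ ∈ infiniteVolumeLimitPoints (d := 4) r.ρ β) {m A : ℝ} (hA : 0 < A) (hm : 0 ≤ m)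
    (hlow : ∀ n : ℕ, A * Real.exp (-(m * n)) ≤ axialCorr r μ n) (n : ℕ) :
    (A / axialCorr r μ 0) ^ ((n : ℝ) + 1)⁻¹ * Real.exp (-m) ≤ lambdaMax r β := by
  have ha0 : 0 < axialCorr r μ 0 := lt_of_lt_of_le (by simpa using hA) (by simpa using hlow 0)
  have hn1 : (0 : ℝ) < (n : ℝ) + 1 := by positivity
  have hexp : ((n : ℝ) + 1)⁻¹ * ((n : ℝ) + 1) = 1 := inv_mul_cancel₀ hn1.ne'
  -- the candidate term
  set t : ℝ := (|axialCorr r μ (n + 1)| / axialCorr r μ 0) ^ ((n : ℝ) + 1)⁻¹ with ht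
  have hlow' : A * Real.exp (-(m * ((n : ℝ) + 1))) ≤ |axialCorr r μ (n + 1)| := by
    have := hlow (n + 1)
    push_cast at this
    exact this.trans (le_abs_self _)
  have hbase : A * Real.exp (-(m * ((n : ℝ) + 1))) / axialCorr r μ 0 ≤
      |axialCorr r μ (n + 1)| / axialCorr r μ 0 :=
    div_le_div_of_nonneg_right hlow' ha0.le
  have hbase0 : 0 ≤ A * Real.exp (-(m * ((n : ℝ) + 1))) / axialCorr r μ 0 := by positivity
  have hkey : (A / axialCorr r μ 0) ^ ((n : ℝ) + 1)⁻¹ * Real.exp (-m) ≤ t := by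
    have h1 : (A * Real.exp (-(m * ((n : ℝ) + 1))) / axialCorr r μ 0) ^ ((n : ℝ) + 1)⁻¹ ≤ t :=
      Real.rpow_le_rpow hbase0 hbase (inv_pos.2 hn1).le
    have h2 : (A * Real.exp (-(m * ((n : ℝ) + 1))) / axialCorr r μ 0) ^ ((n : ℝ) + 1)⁻¹ =
        (A / axialCorr r μ 0) ^ ((n : ℝ) + 1)⁻¹ * Real.exp (-m) := by
      rw [mul_div_right_comm, Real.mul_rpow (by positivity) (Real.exp_pos _).le,
        ← Real.exp_mul]
      congr 1
      congr 1
      calc -(m * ((n : ℝ) + 1)) * ((n : ℝ) + 1)⁻¹ = -m * (((n : ℝ) + 1)⁻¹ * ((n : ℝ) + 1)) := by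
            ring
        _ = -m := by rw [hexp, mul_one]
    rw [← h2]
    exact h1
  -- `t ≤ 1`-clamping does not hurt: the candidate is `≤ 1`? We only need `≤ max 0 (min 1 t)`.
  have hcand1 : (A / axialCorr r μ 0) ^ ((n : ℝ) + 1)⁻¹ * Real.exp (-m) ≤ 1 := by
    have hc : A / axialCorr r μ 0 ≤ 1 := by
      rw [div_le_one ha0]
      simpa using hlow 0
    have h1 : (A / axialCorr r μ 0) ^ ((n : ℝ) + 1)⁻¹ ≤ 1 :=
      Real.rpow_le_one (by positivity) hc (inv_pos.2 hn1).le
    have h2 : Real.exp (-m) ≤ 1 := by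
      rw [Real.exp_le_one_iff]; linarith
    calc (A / axialCorr r μ 0) ^ ((n : ℝ) + 1)⁻¹ * Real.exp (-m) ≤ 1 * 1 :=
          mul_le_mul h1 h2 (Real.exp_pos _).le zero_le_one
      _ = 1 := one_mul _
  have hterm : (A / axialCorr r μ 0) ^ ((n : ℝ) + 1)⁻¹ * Real.exp (-m) ≤ max 0 (min 1 t) :=
    le_max_of_le_right (le_min hcand1 hkey)
  -- climb the two suprema
  have hbdd₁ : BddAbove (Set.range fun k : ℕ =>
      max 0 (min 1 ((|axialCorr r μ (k + 1)| / axialCorr r μ 0) ^ ((k : ℝ) + 1)⁻¹))) :=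
    ⟨1, by rintro _ ⟨k, rfl⟩; exact (lambdaTerm_mem r μ k).2⟩
  have hinner : max 0 (min 1 t) ≤ ⨆ k : ℕ,
      max 0 (min 1 ((|axialCorr r μ (k + 1)| / axialCorr r μ 0) ^ ((k : ℝ) + 1)⁻¹)) :=
    le_ciSup hbdd₁ n
  have hbdd₂ : BddAbove (Set.range fun ν : infiniteVolumeLimitPoints (d := 4) r.ρ β => ⨆ k : ℕ,
      max 0 (min 1 ((|axialCorr r (ν : Measure (LGConfig 4 G)) (k + 1)| /
        axialCorr r (ν : Measure (LGConfig 4 G)) 0) ^ ((k : ℝ) + 1)⁻¹))) :=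
    ⟨1, by
      rintro _ ⟨ν, rfl⟩
      exact Real.iSup_le (fun k => (lambdaTerm_mem r _ k).2) zero_le_one⟩
  have houter := le_ciSup hbdd₂ ⟨μ, hμ⟩
  exact hterm.trans (hinner.trans houter)

/-- **Stub XI is item stmt-QuantumFields-8941.**  `XiCompleteMonotonicity.XiDiverges` (the
qualitative payoff `ξ_lat(β) → ∞` uniformly over limit points, itself implied by that route's
target `XiExpLowerBound`, stmt-QuantumFields-8935) implies `Statement.stub_lockDiverges`, using
only the discharged fact `infiniteVolumeLimitPoints_nonempty_holds`. -/
theorem lockDiverges_of_xiDiverges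
    (hX : Summit.QuantumFields.YangMills.Theses.XiCompleteMonotonicity.XiDiverges) :
    Statement.stub_lockDiverges := by
  intro G _ _ _ _ _ _ hG r
  haveI : T2Space G := (r.continuous.isClosedEmbedding r.injective).isEmbedding.t2Space
  haveI : SecondCountableTopology G :=
    (r.continuous.isClosedEmbedding r.injective).isEmbedding.secondCountableTopology
  rw [LockDiverges, Metric.tendsto_atTop]
  intro ε hε
  -- limit points exist at every coupling
  have hne : ∀ β : ℝ, (infiniteVolumeLimitPoints (d := 4) r.ρ β).Nonempty :=
    fun β => infiniteVolumeLimitPoints_nonempty_holds (d := 4) r.ρ r.continuous β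
  by_cases hε1 : 1 < ε
  · refine ⟨0, fun β _ => ?_⟩
    rw [Real.dist_eq, abs_sub_lt_iff]
    have := lambdaMax_mem r β
    constructor <;> linarith [this.1, this.2]
  · push Not at hε1
    -- ξ diverges: rate ≤ ε/2 beyond β₁
    obtain ⟨β₁, hβ₁⟩ := hX G hG r (ε / 2) (by positivity)
    refine ⟨β₁, fun β hβ => ?_⟩
    obtain ⟨μ, hμ⟩ := hne β
    obtain ⟨m, A, hA, hm0, hmε, hlow0⟩ := hβ₁ β hβ μ hμ
    have hlow : ∀ n : ℕ, A * Real.exp (-(m * n)) ≤ axialCorr r μ n := fun n => hlow0 n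
    have ha0 : 0 < axialCorr r μ 0 := lt_of_lt_of_le (by simpa using hA) (by simpa using hlow 0)
    -- the root factor tends to 1: pick n with (A/a₀)^{1/(n+1)} ≥ 1 - ε/4
    set c : ℝ := A / axialCorr r μ 0 with hc
    have hc0 : 0 < c := div_pos hA ha0
    have hroot : Tendsto (fun n : ℕ => c ^ ((n : ℝ) + 1)⁻¹) atTop (𝓝 1) := by
      have h1 : Tendsto (fun n : ℕ => ((n : ℝ) + 1)⁻¹) atTop (𝓝 0) :=
        tendsto_inv_atTop_zero.comp (tendsto_natCast_atTop_atTop.atTop_add tendsto_const_nhds)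
      have h2 : Tendsto (fun n : ℕ => Real.log c * ((n : ℝ) + 1)⁻¹) atTop (𝓝 0) := by
        simpa using h1.const_mul (Real.log c)
      have h3 := (Real.continuous_exp.tendsto 0).comp h2
      rw [Real.exp_zero] at h3
      refine h3.congr fun n => ?_
      simp only [Function.comp_apply]
      rw [Real.rpow_def_of_pos hc0]
    have hev : ∀ᶠ n : ℕ in atTop, 1 - ε / 4 < c ^ ((n : ℝ) + 1)⁻¹ :=
      hroot.eventually (lt_mem_nhds (by linarith))
    obtain ⟨n, hn⟩ := hev.exists
    have hlam := rpow_mul_exp_le_lambdaMax r hμ hA hm0 hlow n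
    have hexp : 1 - ε / 2 ≤ Real.exp (-m) := by
      have := Real.add_one_le_exp (-m)
      linarith
    have hprod : (1 - ε / 4) * (1 - ε / 2) ≤ c ^ ((n : ℝ) + 1)⁻¹ * Real.exp (-m) :=
      mul_le_mul hn.le hexp (by linarith) (Real.rpow_nonneg hc0.le _)
    rw [Real.dist_eq, abs_sub_lt_iff]
    have := lambdaMax_mem r β
    constructor
    · linarith [this.2]
    · nlinarith [this.1, hprod, hlam]

end XiGlue

/-! ### Species bookkeeping for the composition (Disproof §4, over the landed `Negative.extendByZero`) -/

section OneField

open Summit.QuantumFields.YangMills.Theorems.HypercubicLimit.Negative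

variable {G : Type} [Group G] [TopologicalSpace G] [IsTopologicalGroup G] [CompactSpace G]
  [MeasurableSpace G] [BorelSpace G]

/-- The scheme keeping the renormalisations of `s₀` and renormalising every other species to `0`. -/
def onlySpecies (sch : SpeciesScheme (YMSpecies G)) (s₀ : YMSpecies G) :
    SpeciesScheme (YMSpecies G) :=
  { sch with c := fun s k => by classical exact if s = s₀ then sch.c s k else 0 }

omit [Group G] [TopologicalSpace G] [IsTopologicalGroup G] [CompactSpace G] [BorelSpace G] in
/-- A species with zero multiplicative renormalisation has the zero smeared field. -/
theorem smearedLatticeField_zero_c (O : LGConfig 4 G → ℝ)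
    (Λ : Finset (Literature.Probability.LatticeModels.Site 4)) (a m : ℝ) (f : 𝓢(E4, ℝ))
    (U : LGConfig 4 G) : smearedLatticeField O Λ a 0 m f U = 0 := by
  simp [smearedLatticeField]

/-- With a species of zero multiplicative renormalisation in the string, the lattice `n`-point
function vanishes. -/
theorem latticeSchwinger_onlySpecies_of_ne (r : LatticeRep G) (sch : SpeciesScheme (YMSpecies G))
    (s₀ : YMSpecies G) (k n : ℕ) (σ : Fin n → YMSpecies G) (f : Fin n → 𝓢(E4, ℝ)) {i₀ : Fin n}
    (hi₀ : σ i₀ ≠ s₀) :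
    latticeSchwinger r.ρ (onlySpecies sch s₀) (fun s => s.F) k n σ f = 0 := by
  unfold latticeSchwinger
  have h0 : (onlySpecies sch s₀).c (σ i₀) k = 0 := by
    simp [onlySpecies, hi₀]
  have : ∀ U : GaugeConfig 4 ((onlySpecies sch s₀).side k) G,
      ∏ i, smearedLatticeField ((fun s : YMSpecies G => s.F) (σ i))
        (Literature.Probability.LatticeModels.box 4 ((onlySpecies sch s₀).L k))
        ((onlySpecies sch s₀).a k) ((onlySpecies sch s₀).c (σ i) k) ((onlySpecies sch s₀).m (σ i) k)
        (f i) (torusLift ((onlySpecies sch s₀).side k) U) = 0 := fun U =>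
    Finset.prod_eq_zero (Finset.mem_univ i₀) (by rw [h0, smearedLatticeField_zero_c])
  simp_rw [this, integral_zero]

/-- On the distinguished species the modified scheme has the original lattice functions. -/
theorem latticeSchwinger_onlySpecies_self (r : LatticeRep G) (sch : SpeciesScheme (YMSpecies G))
    (s₀ : YMSpecies G) (k n : ℕ) (f : Fin n → 𝓢(E4, ℝ)) :
    latticeSchwinger r.ρ (onlySpecies sch s₀) (fun s => s.F) k n (fun _ => s₀) f =
      latticeSchwinger r.ρ sch (fun s => s.F) k n (fun _ => s₀) f := by
  have hc : (onlySpecies sch s₀).c s₀ k = sch.c s₀ k := by simp [onlySpecies]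
  unfold latticeSchwinger
  simp_rw [hc]
  rfl

end OneField

/-! ### The composition: the crux from the five stubs -/

/-- **`HypercubicLimit` from the five stubs** (kernel-checked, no `sorry` here): for a compact
simple `G` take the faithful representation `r` it provides, run the transfer on the four locked
inputs to get a scheme `sch` and a one-field family `S₁` with `OneFieldClauses`, then present the
all-species witness `(r, onlySpecies sch r.curvature, extendByZero r.curvature S₁)`: every other
species is renormalised to zero and the family is extended by zero, which preserves E0–E4,
translation / hypercubic invariance and the continuum gap (landed `Negative.osClauses_extendByZero`,
`Negative.hasMassGap_extendByZero`), keeps the curvature strings (convergence, non-triviality,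
non-Gaussianity verbatim) and does not touch `(a, β, L)` (so `HasLatticeMassGap` is verbatim). -/
theorem HypercubicLimit_of :
    Statement.stub_lockDiverges → Statement.stub_lockedGap → Statement.stub_lockedGrowth →
      Statement.stub_lockedSkewness → Statement.stub_lockedOSLimit →
        Summit.QuantumFields.YangMills.Theses.PencilRigidity.HypercubicLimit := by
  intro hXI hIR hUV hNG hT G _ _ _ _ hG
  letI : MeasurableSpace G := borel G
  haveI : BorelSpace G := ⟨rfl⟩
  obtain ⟨r⟩ := hG.2
  obtain ⟨sch, S₁, hos, hconv, hnt, hng, Δ, hΔ, hgap, hlat⟩ :=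
    hT G hG r (hXI G hG r) (hIR G hG r) (hUV G hG r) (hNG G hG r)
  refine ⟨r, onlySpecies sch r.curvature,
    Summit.QuantumFields.YangMills.Theorems.HypercubicLimit.Negative.extendByZero r.curvature S₁,
    Summit.QuantumFields.YangMills.Theorems.HypercubicLimit.Negative.osClauses_extendByZero hos,
    ?_, ?_, ?_, Δ, hΔ,
    Summit.QuantumFields.YangMills.Theorems.HypercubicLimit.Negative.hasMassGap_extendByZero hgap,
    hlat⟩
  · -- convergence of every species string: the curvature string verbatim, every other string is 0
    intro n hn σ f F hF hod
    by_cases hσ : ∀ i, σ i = r.curvature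
    · obtain rfl : σ = fun _ => r.curvature := funext hσ
      rw [Summit.QuantumFields.YangMills.Theorems.HypercubicLimit.Negative.extendByZero_const]
      simp_rw [latticeSchwinger_onlySpecies_self]
      exact hconv n hn f F hF hod
    · push Not at hσ
      obtain ⟨i₀, hi₀⟩ := hσ
      rw [Summit.QuantumFields.YangMills.Theorems.HypercubicLimit.Negative.extendByZero_of_not_all
        _ _ (fun hall => hi₀ (hall i₀))]
      simp_rw [latticeSchwinger_onlySpecies_of_ne r sch r.curvature _ n σ f hi₀]
      simp
  · -- non-triviality of the curvature species (constant curvature string)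
    simpa using hnt
  · -- non-Gaussianity of the curvature species
    simpa using hng

/-- The same composition for the SHARED copies of the crux decl (item stmt-QuantumFields-8646 is
wanted verbatim by three routes; the three `def HypercubicLimit` are definitionally equal, so the
proof term is reused — whichever decl the skeleton audit resolves, a theorem concludes it BY NAME). -/
theorem HypercubicLimit_of_mirrorModularBoosts :
    Statement.stub_lockDiverges → Statement.stub_lockedGap → Statement.stub_lockedGrowth →
      Statement.stub_lockedSkewness → Statement.stub_lockedOSLimit →
        Summit.QuantumFields.YangMills.Theses.MirrorModularBoosts.HypercubicLimit :=
  fun h₁ h₂ h₃ h₄ h₅ => HypercubicLimit_of h₁ h₂ h₃ h₄ h₅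

/-- See `HypercubicLimit_of_mirrorModularBoosts`. -/
theorem HypercubicLimit_of_coincidenceRotationBootstrap :
    Statement.stub_lockDiverges → Statement.stub_lockedGap → Statement.stub_lockedGrowth →
      Statement.stub_lockedSkewness → Statement.stub_lockedOSLimit →
        Summit.QuantumFields.YangMills.Theses.CoincidenceRotationBootstrap.HypercubicLimit :=
  fun h₁ h₂ h₃ h₄ h₅ => HypercubicLimit_of h₁ h₂ h₃ h₄ h₅

/-- The crux modulo the registered stubs (here `sorry` enters, through the stubs only). -/
example : Summit.QuantumFields.YangMills.Theses.PencilRigidity.HypercubicLimit :=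
  HypercubicLimit_of stub_lockDiverges stub_lockedGap stub_lockedGrowth stub_lockedSkewness
    stub_lockedOSLimit

end Summit.QuantumFields.YangMills.Cruxes.HypercubicLimit.ScaleLockedAssembly

end
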